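import Summits.Ventures.PercRepro.Night2FatXUnloaded
import Summits.Ventures.PercRepro.Night2BasisLoadedC

/-!
# night-2: the fat case when the loads sit at the low levels — no four collinear points, `N ≥ 7`

A loaded target contains a rank-`2` set `R` with `|R| + 5 ≤ |T ∖ K|` (`loaded_target_structure`), so when no line
of `V` carries four points every loaded target has `|T ∖ K| ≤ 8`, i.e. lies at level `≤ 3` above `Q`
(`card_sdiff_le_eight_of_dload_ne_zero_of_lines_le_three`).  The fat count criterion then needs only the levels `1`,
`4`, `5` (`fat_count_level_ge'`, the level bound with the load hypothesis restricted to that level), which give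
`110/221 + 20/42.98 + 15/85.96 > 1` at `N = 7`, `≈ 1.40` at `N = 8` and `≥ 110/221 + 56 · 22/1547 > 1` for `N ≥ 9`
(`fat_count_numeric_high`).  Hence `basis_pair_fair_fat_of_low_loads` and the second closed sub-case
`localShadowHall_fat_of_lines_le_three`: the (2,1) cell with a fat closure, no four collinear points off `K` and
`|G| ≥ 13`.  Paper `proofs/NIGHT-2-g32.md` §3.8.
-/

namespace PercRepro.Shadow

open PercRepro.ThmH PercRepro.PerFlat

variable {α : Type*} [DecidableEq α] {M : Matroid α} [M.Finite] {G : Finset α}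

/-- **The level-`j` bound of the fat count sum with the load hypothesis restricted to level `j`.** -/
theorem fat_count_level_ge' (hG : G ∈ flatsQ M (5 + 1)) (hd : (gr M \ G).card = 2) (hk : kColoops M G = 1)
    {B : Finset α} (hB : B ∈ thinMembers M 5 G) (hnP : ¬ bigP M G B) {z : α} (hz : z ∈ G \ clF M B) {x : α}
    (hx : x ∈ G \ insert z B) {j : ℕ} (hj : 1 ≤ j)
    (hload : ∀ T ∈ tgtSets M 5 G B z, x ∈ T → (T \ insert z B).card = j →
      dload M 5 G (bigP M G) (dshGT2 M 5 G) T = 0) :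
    ((((G \ insert z B).card - 1).choose (j - 1) : ℕ) : ℚ) *
      fatTerm j (if (G \ insert z B).card - j ≤ 3 then 1 else 11 / 18) ≤
      ∑ T ∈ ((tgtSets M 5 G B z).filter
        (fun T => x ∈ T ∧ dload M 5 G (bigP M G) (dshGT2 M 5 G) T = 0)).filter
        (fun T => (T \ insert z B).card = j),
        capS M 5 G T / ((221 / 360 : ℚ) * ((2 * ((T \ coloops M G).card - 2).choose 4 : ℕ) : ℚ)) := by
  have hQG : insert z B ⊆ G :=
    Finset.insert_subset (Finset.mem_sdiff.1 hz).1 (subset_G_of_mem_thinMembers hB)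
  have hd' : (gr M \ G).card ≤ 5 := by omega
  have hKQ : coloops M G ⊆ insert z B :=
    (coloops_subset_of_mem_thinMembers hG hd' hB).trans (Finset.subset_insert _ _)
  have hQ5 := card_insert_sdiff_eq_five hG hd hk hB hnP hz
  have hcount := choose_le_card_targets_level hG hB hz (Finset.singleton_subset_iff.2 hx) hj
    (by rw [Finset.card_singleton]; exact hj)
  rw [Finset.card_singleton] at hcount
  set F := ((tgtSets M 5 G B z).filter
    (fun T => x ∈ T ∧ dload M 5 G (bigP M G) (dshGT2 M 5 G) T = 0)).filter
    (fun T => (T \ insert z B).card = j) with hF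
  set c : ℚ := if (G \ insert z B).card - j ≤ 3 then 1 else 11 / 18 with hc
  have hsub : (tgtSets M 5 G B z).filter (fun T => {x} ⊆ T ∧ (T \ insert z B).card = j) ⊆ F := by
    intro T hT
    rw [Finset.mem_filter] at hT
    rw [hF, Finset.mem_filter, Finset.mem_filter]
    have hxT : x ∈ T := Finset.singleton_subset_iff.1 hT.2.1
    exact ⟨⟨hT.1, hxT, hload T hT.1 hxT hT.2.2⟩, hT.2.2⟩
  have hcard : ((((G \ insert z B).card - 1).choose (j - 1) : ℕ) : ℚ) ≤ (F.card : ℚ) := by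
    exact_mod_cast hcount.trans (Finset.card_le_card hsub)
  have hterm : ∀ T ∈ F, fatTerm j c ≤
      capS M 5 G T / ((221 / 360 : ℚ) * ((2 * ((T \ coloops M G).card - 2).choose 4 : ℕ) : ℚ)) := by
    intro T hT
    rw [hF, Finset.mem_filter, Finset.mem_filter] at hT
    obtain ⟨⟨hTt, -, -⟩, hTj⟩ := hT
    have hTG : T ⊆ G := subset_G_of_mem_shadowAt (mem_tgtSets.1 hTt).1
    have hQT : insert z B ⊆ T := (mem_tgtSets.1 hTt).2.1
    have hTK : (T \ coloops M G).card = j + 5 := by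
      have h1 : T \ coloops M G = (T \ insert z B) ∪ (insert z B \ coloops M G) := by
        ext e
        simp only [Finset.mem_sdiff, Finset.mem_union]
        constructor
        · rintro ⟨heT, heK⟩
          by_cases heQ : e ∈ insert z B
          · exact Or.inr ⟨heQ, heK⟩
          · exact Or.inl ⟨heT, heQ⟩
        · rintro (⟨heT, heQ⟩ | ⟨heQ, heK⟩)
          · exact ⟨heT, fun h => heQ (hKQ h)⟩
          · exact ⟨hQT heQ, heK⟩
      have hdisj : Disjoint (T \ insert z B) (insert z B \ coloops M G) := by
        rw [Finset.disjoint_left]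
        intro e h1 h2
        exact (Finset.mem_sdiff.1 h1).2 (Finset.mem_sdiff.1 h2).1
      rw [h1, Finset.card_union_of_disjoint hdisj, hTj, hQ5]
    have hGT : (G \ T).card = (G \ insert z B).card - j := by
      have h1 : G \ insert z B = (G \ T) ∪ (T \ insert z B) := by
        ext e
        simp only [Finset.mem_sdiff, Finset.mem_union]
        constructor
        · rintro ⟨heG, heQ⟩
          by_cases heT : e ∈ T
          · exact Or.inr ⟨heT, heQ⟩
          · exact Or.inl ⟨heG, heT⟩
        · rintro (⟨heG, heT⟩ | ⟨heT, heQ⟩)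
          · exact ⟨heG, fun h => heT (hQT h)⟩
          · exact ⟨hTG heT, heQ⟩
      have hdisj : Disjoint (G \ T) (T \ insert z B) := by
        rw [Finset.disjoint_left]
        intro e h1 h2
        exact (Finset.mem_sdiff.1 h1).2 (Finset.mem_sdiff.1 h2).1
      rw [h1, Finset.card_union_of_disjoint hdisj, hTj]
      omega
    have hcap : c ≤ capS M 5 G T := by
      rw [hc]
      split_ifs with h3
      · rw [capS_eq_one_of_card_sdiff_le_three hd (by rw [hGT]; exact h3)]
      · exact capS_ge_eleven_eighteenths_two_one hd hk hTG
    unfold fatTerm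
    rw [hTK, show j + 5 - 2 = j + 3 by omega]
    apply div_le_div_of_nonneg_right hcap
    positivity
  calc ((((G \ insert z B).card - 1).choose (j - 1) : ℕ) : ℚ) * fatTerm j c
      ≤ (F.card : ℚ) * fatTerm j c := by
        apply mul_le_mul_of_nonneg_right hcard
        unfold fatTerm
        rw [hc]
        split_ifs <;> positivity
    _ = ∑ _T ∈ F, fatTerm j c := by rw [Finset.sum_const, nsmul_eq_mul]
    _ ≤ ∑ T ∈ F, capS M 5 G T /
        ((221 / 360 : ℚ) * ((2 * ((T \ coloops M G).card - 2).choose 4 : ℕ) : ℚ)) :=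
        Finset.sum_le_sum hterm

/-- The fat count sum dominates the sum of its levels `1`, `4`, `5`. -/
theorem fat_count_sum_ge_levels_one_four_five (hG : G ∈ flatsQ M (5 + 1)) (hd : (gr M \ G).card = 2)
    {B : Finset α} {z : α} {x : α} :
    (∑ T ∈ ((tgtSets M 5 G B z).filter
        (fun T => x ∈ T ∧ dload M 5 G (bigP M G) (dshGT2 M 5 G) T = 0)).filter
        (fun T => (T \ insert z B).card = 1),
        capS M 5 G T / ((221 / 360 : ℚ) * ((2 * ((T \ coloops M G).card - 2).choose 4 : ℕ) : ℚ))) +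
    (∑ T ∈ ((tgtSets M 5 G B z).filter
        (fun T => x ∈ T ∧ dload M 5 G (bigP M G) (dshGT2 M 5 G) T = 0)).filter
        (fun T => (T \ insert z B).card = 4),
        capS M 5 G T / ((221 / 360 : ℚ) * ((2 * ((T \ coloops M G).card - 2).choose 4 : ℕ) : ℚ))) +
    (∑ T ∈ ((tgtSets M 5 G B z).filter
        (fun T => x ∈ T ∧ dload M 5 G (bigP M G) (dshGT2 M 5 G) T = 0)).filter
        (fun T => (T \ insert z B).card = 5),
        capS M 5 G T / ((221 / 360 : ℚ) * ((2 * ((T \ coloops M G).card - 2).choose 4 : ℕ) : ℚ))) ≤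
    ∑ T ∈ (tgtSets M 5 G B z).filter
        (fun T => x ∈ T ∧ dload M 5 G (bigP M G) (dshGT2 M 5 G) T = 0),
        capS M 5 G T / ((221 / 360 : ℚ) * ((2 * ((T \ coloops M G).card - 2).choose 4 : ℕ) : ℚ)) := by
  have hd' : (gr M \ G).card ≤ 5 := by omega
  set F := (tgtSets M 5 G B z).filter
    (fun T => x ∈ T ∧ dload M 5 G (bigP M G) (dshGT2 M 5 G) T = 0) with hF
  set f : Finset α → ℚ := fun T =>
    capS M 5 G T / ((221 / 360 : ℚ) * ((2 * ((T \ coloops M G).card - 2).choose 4 : ℕ) : ℚ)) with hf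
  have hf0 : ∀ T ∈ F, 0 ≤ f T := fun T _ => div_nonneg (capS_nonneg' hG hd' T) (by positivity)
  have h14 : Disjoint (F.filter (fun T => (T \ insert z B).card = 1))
      (F.filter (fun T => (T \ insert z B).card = 4)) := by
    rw [Finset.disjoint_left]
    intro T h1 h2
    rw [Finset.mem_filter] at h1 h2
    have := h1.2
    have := h2.2
    omega
  have h145 : Disjoint (F.filter (fun T => (T \ insert z B).card = 1) ∪
      F.filter (fun T => (T \ insert z B).card = 4)) (F.filter (fun T => (T \ insert z B).card = 5)) := by
    rw [Finset.disjoint_left]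
    intro T h1 h2
    simp only [Finset.mem_union, Finset.mem_filter] at h1 h2
    rcases h1 with ⟨-, h1⟩ | ⟨-, h1⟩ <;> omega
  rw [← Finset.sum_union h14, ← Finset.sum_union h145]
  apply Finset.sum_le_sum_of_subset_of_nonneg
  · intro T hT
    simp only [Finset.mem_union, Finset.mem_filter] at hT
    rcases hT with (⟨h, -⟩ | ⟨h, -⟩) | ⟨h, -⟩ <;> exact h
  · intro T hT _
    exact hf0 T hT

/-- **The numerical core for `N ≥ 7`**: the levels `1`, `4`, `5` give at least `1`. -/
theorem fat_count_numeric_high (N : ℕ) (hN : 7 ≤ N) :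
    (1 : ℚ) ≤ (((N - 1).choose (1 - 1) : ℕ) : ℚ) * fatTerm 1 (if N - 1 ≤ 3 then 1 else 11 / 18) +
      (((N - 1).choose (4 - 1) : ℕ) : ℚ) * fatTerm 4 (if N - 4 ≤ 3 then 1 else 11 / 18) +
      (((N - 1).choose (5 - 1) : ℕ) : ℚ) * fatTerm 5 (if N - 5 ≤ 3 then 1 else 11 / 18) := by
  unfold fatTerm
  rcases Nat.lt_or_ge N 9 with h9 | h9
  · interval_cases N <;> norm_num [Nat.choose]
  · -- `N ≥ 9`: the levels `1` and `4` with `capS ≥ 11/18` suffice (`C(N − 1, 3) ≥ 56`)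
    have hc0 : (((N - 1).choose (1 - 1) : ℕ) : ℚ) = 1 := by simp
    have h56 : (56 : ℚ) ≤ (((N - 1).choose (4 - 1) : ℕ) : ℚ) := by
      have : (8 : ℕ).choose 3 ≤ (N - 1).choose 3 := Nat.choose_le_choose 3 (by omega)
      have h8 : (8 : ℕ).choose 3 = 56 := by decide
      have : (56 : ℕ) ≤ (N - 1).choose (4 - 1) := by
        rw [show (4 : ℕ) - 1 = 3 from rfl]
        omega
      exact_mod_cast this
    have hif1 : (if N - 1 ≤ 3 then (1 : ℚ) else 11 / 18) ≥ 11 / 18 := by split_ifs <;> norm_num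
    have hif4 : (if N - 4 ≤ 3 then (1 : ℚ) else 11 / 18) ≥ 11 / 18 := by split_ifs <;> norm_num
    have hif5 : (if N - 5 ≤ 3 then (1 : ℚ) else 11 / 18) ≥ 11 / 18 := by split_ifs <;> norm_num
    have hpos5 : (0 : ℚ) ≤ (((N - 1).choose (5 - 1) : ℕ) : ℚ) *
        ((if N - 5 ≤ 3 then (1 : ℚ) else 11 / 18) / ((221 / 360 : ℚ) * ((2 * (5 + 3).choose 4 : ℕ) : ℚ))) := by
      apply mul_nonneg (Nat.cast_nonneg _)
      apply div_nonneg (le_trans (by norm_num) hif5)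
      positivity
    rw [hc0]
    have h1 : (11 / 18 : ℚ) / ((221 / 360 : ℚ) * ((2 * (1 + 3).choose 4 : ℕ) : ℚ)) ≤
        1 * ((if N - 1 ≤ 3 then (1 : ℚ) else 11 / 18) / ((221 / 360 : ℚ) * ((2 * (1 + 3).choose 4 : ℕ) : ℚ))) := by
      rw [one_mul]
      apply div_le_div_of_nonneg_right hif1
      positivity
    have h4 : (56 : ℚ) * ((11 / 18 : ℚ) / ((221 / 360 : ℚ) * ((2 * (4 + 3).choose 4 : ℕ) : ℚ))) ≤
        (((N - 1).choose (4 - 1) : ℕ) : ℚ) * ((if N - 4 ≤ 3 then (1 : ℚ) else 11 / 18) /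
          ((221 / 360 : ℚ) * ((2 * (4 + 3).choose 4 : ℕ) : ℚ))) := by
      apply mul_le_mul h56 (div_le_div_of_nonneg_right hif4 (by positivity)) (by positivity)
        (Nat.cast_nonneg _)
    have hnum : (1 : ℚ) ≤ (11 / 18 : ℚ) / ((221 / 360 : ℚ) * ((2 * (1 + 3).choose 4 : ℕ) : ℚ)) +
        (56 : ℚ) * ((11 / 18 : ℚ) / ((221 / 360 : ℚ) * ((2 * (4 + 3).choose 4 : ℕ) : ℚ))) := by
      norm_num [Nat.choose]
    linarith

/-- `|T ∖ K| = |T ∖ Q| + 5` at a target of a basis pair. -/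
theorem card_sdiff_coloops_eq_level_add_five (hG : G ∈ flatsQ M (5 + 1)) (hd : (gr M \ G).card = 2)
    (hk : kColoops M G = 1) {B : Finset α} (hB : B ∈ thinMembers M 5 G) (hnP : ¬ bigP M G B) {z : α}
    (hz : z ∈ G \ clF M B) {T : Finset α} (hT : T ∈ tgtSets M 5 G B z) :
    (T \ coloops M G).card = (T \ insert z B).card + 5 := by
  have hd' : (gr M \ G).card ≤ 5 := by omega
  have hKQ : coloops M G ⊆ insert z B :=
    (coloops_subset_of_mem_thinMembers hG hd' hB).trans (Finset.subset_insert _ _)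
  have hQT : insert z B ⊆ T := (mem_tgtSets.1 hT).2.1
  have hQ5 := card_insert_sdiff_eq_five hG hd hk hB hnP hz
  have h1 : T \ coloops M G = (T \ insert z B) ∪ (insert z B \ coloops M G) := by
    ext e
    simp only [Finset.mem_sdiff, Finset.mem_union]
    constructor
    · rintro ⟨heT, heK⟩
      by_cases heQ : e ∈ insert z B
      · exact Or.inr ⟨heQ, heK⟩
      · exact Or.inl ⟨heT, heQ⟩
    · rintro (⟨heT, heQ⟩ | ⟨heQ, heK⟩)
      · exact ⟨heT, fun h => heQ (hKQ h)⟩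
      · exact ⟨hQT heQ, heK⟩
  have hdisj : Disjoint (T \ insert z B) (insert z B \ coloops M G) := by
    rw [Finset.disjoint_left]
    intro e h1 h2
    exact (Finset.mem_sdiff.1 h1).2 (Finset.mem_sdiff.1 h2).1
  rw [h1, Finset.card_union_of_disjoint hdisj, hQ5]

/-- **The fat count criterion holds when the loads sit at levels `≤ 3` and `N ≥ 7`.** -/
theorem fat_count_sum_ge_one_of_low_loads (hG : G ∈ flatsQ M (5 + 1)) (hd : (gr M \ G).card = 2)
    (hk : kColoops M G = 1) (hs : ∀ e ∈ gr M, ∀ f ∈ gr M, e ≠ f → rkN M {e, f} = 2)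
    (hl : ∀ e ∈ gr M, M.Indep {e}) {B : Finset α} (hB : B ∈ thinMembers M 5 G) (hnP : ¬ bigP M G B)
    {z : α} (hz : z ∈ G \ clF M B) {x : α} (hx : x ∈ G \ insert z B) (hN : 7 ≤ (G \ insert z B).card)
    (hload : ∀ T ∈ tgtSets M 5 G B z, x ∈ T → 4 ≤ (T \ insert z B).card →
      dload M 5 G (bigP M G) (dshGT2 M 5 G) T = 0) :
    1 ≤ ∑ T ∈ (tgtSets M 5 G B z).filter
      (fun T => x ∈ T ∧ dload M 5 G (bigP M G) (dshGT2 M 5 G) T = 0),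
      capS M 5 G T / ((221 / 360 : ℚ) * ((2 * ((T \ coloops M G).card - 2).choose 4 : ℕ) : ℚ)) := by
  have hl1 := fat_count_level_ge' hG hd hk hB hnP hz hx (j := 1) (by norm_num)
    (fun T hT _ h1 => dload_eq_zero_of_card_sdiff_le_six hG hd hk hs hl
      (by rw [card_sdiff_coloops_eq_level_add_five hG hd hk hB hnP hz hT, h1]))
  have hl4 := fat_count_level_ge' hG hd hk hB hnP hz hx (j := 4) (by norm_num)
    (fun T hT hxT h4 => hload T hT hxT (by omega))
  have hl5 := fat_count_level_ge' hG hd hk hB hnP hz hx (j := 5) (by norm_num)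
    (fun T hT hxT h5 => hload T hT hxT (by omega))
  have hlev := fat_count_sum_ge_levels_one_four_five hG hd (B := B) (z := z) (x := x)
  have hnum := fat_count_numeric_high (G \ insert z B).card hN
  linarith

/-- **The fat case of (FAIR) when the loads sit at levels `≤ 3` and `N ≥ 7`.** -/
theorem basis_pair_fair_fat_of_low_loads (hG : G ∈ flatsQ M (5 + 1)) (hd : (gr M \ G).card = 2)
    (hk : kColoops M G = 1) (hs : ∀ e ∈ gr M, ∀ f ∈ gr M, e ≠ f → rkN M {e, f} = 2)
    (hl : ∀ e ∈ gr M, M.Indep {e}) (hfat : (fatClosures M 5 G 2).card ≤ 1)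
    {B₀ : Finset α} (hB₀ : B₀ ∈ thinMembers M 5 G) {w₀ x : α} (hD : G \ clF M B₀ = {w₀, x}) (hne : w₀ ≠ x)
    {B : Finset α} (hB : B ∈ thinMembers M 5 G) (hnP : ¬ bigP M G B) {z : α} (hz : z ∈ G \ clF M B)
    (hl0 : loss M 5 G B z ≠ 0) (hw₀ : w₀ ∈ insert z B) (hx : x ∉ insert z B) (hN : 7 ≤ (G \ insert z B).card)
    (hload : ∀ T ∈ tgtSets M 5 G B z, x ∈ T → 4 ≤ (T \ insert z B).card →
      dload M 5 G (bigP M G) (dshGT2 M 5 G) T = 0) :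
    loss M 5 G B z ≤ rhoL M 5 G B z * lossIncomeH M 5 G (bigP M G) (dshGT2 M 5 G) B z := by
  have hxG : x ∈ G \ insert z B := by
    refine Finset.mem_sdiff.2 ⟨?_, hx⟩
    have : x ∈ G \ clF M B₀ := by
      rw [hD]
      exact Finset.mem_insert_of_mem (Finset.mem_singleton_self _)
    exact (Finset.mem_sdiff.1 this).1
  exact basis_pair_fair_of_fat_count_sum hG hd hk hs hl hfat hB₀ hD hne hB hnP hz hl0 hw₀ hx
    (fat_count_sum_ge_one_of_low_loads hG hd hk hs hl hB hnP hz hxG hN hload)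

/-- **With no four collinear points off `K`, every loaded target has at most eight points off `K`.** -/
theorem card_sdiff_le_eight_of_dload_ne_zero_of_lines_le_three (hG : G ∈ flatsQ M (5 + 1))
    (hd : (gr M \ G).card = 2) (hk : kColoops M G = 1)
    (hs : ∀ e ∈ gr M, ∀ f ∈ gr M, e ≠ f → rkN M {e, f} = 2) (hl : ∀ e ∈ gr M, M.Indep {e})
    (htri : ∀ R ⊆ G \ coloops M G, rkN M R = 2 → R.card ≤ 3) {T : Finset α} (hTG : T ⊆ G)
    (hne : dload M 5 G (bigP M G) (dshGT2 M 5 G) T ≠ 0) : (T \ coloops M G).card ≤ 8 := by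
  obtain ⟨R, hR, hr2, -, h5⟩ := loaded_target_structure hG hd hk hs hl hTG hne
  have h3 := htri R (hR.trans (Finset.sdiff_subset_sdiff hTG (Finset.Subset.refl _))) hr2
  have := Finset.card_sdiff_add_card_eq_card hR
  omega

/-- **The (2,1) cell of h21 with a fat closure, no four collinear points off `K` and `|G| ≥ 13`**: the local Hall
inequality. -/
theorem localShadowHall_fat_of_lines_le_three (hG : G ∈ flatsQ M (5 + 1)) (hd : (gr M \ G).card = 2)
    (hk : kColoops M G = 1) (hs : ∀ e ∈ gr M, ∀ f ∈ gr M, e ≠ f → rkN M {e, f} = 2)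
    (hl : ∀ e ∈ gr M, M.Indep {e}) (hfat : (fatClosures M 5 G 2).card ≤ 1)
    {B₀ : Finset α} (hB₀ : B₀ ∈ thinMembers M 5 G) (hm₀ : (G \ clF M B₀).card = 2)
    (htri : ∀ R ⊆ G \ coloops M G, rkN M R = 2 → R.card ≤ 3) (hG13 : 13 ≤ G.card) :
    LocalShadowHall M 5 G := by
  apply localShadowHall_of_gt2_of_basis_fair hG hd hk hs hl hfat
  intro B hB hnP z hz
  have hd' : (gr M \ G).card ≤ 5 := by omega
  by_cases hl0 : loss M 5 G B z = 0
  · rw [hl0]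
    have h1 : 0 ≤ rhoL M 5 G B z := by
      unfold rhoL
      rw [hl0]
      simp
    have h2 : 0 ≤ lossIncomeH M 5 G (bigP M G) (dshGT2 M 5 G) B z :=
      lossIncomeH_nonneg hG hd' (column_side_gt2 hG hd hk hs hl hfat) B z
    positivity
  · obtain ⟨w₀, x, hD, hne, hw₀, hx⟩ := exists_fat_split hG hd hk hB₀ hm₀ hB hz hl0
    -- `N = |G ∖ Q| = |G| − 6 ≥ 7`
    have hN : 7 ≤ (G \ insert z B).card := by
      have hQG : insert z B ⊆ G :=
        Finset.insert_subset (Finset.mem_sdiff.1 hz).1 (subset_G_of_mem_thinMembers hB)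
      have hKQ : coloops M G ⊆ insert z B :=
        (coloops_subset_of_mem_thinMembers hG hd' hB).trans (Finset.subset_insert _ _)
      have hQ5 := card_insert_sdiff_eq_five hG hd hk hB hnP hz
      have h1 := Finset.card_sdiff_add_card_eq_card hKQ
      rw [← kColoops_eq_card_coloops, hk, hQ5] at h1
      have h2 := Finset.card_sdiff_add_card_eq_card hQG
      omega
    refine basis_pair_fair_fat_of_low_loads hG hd hk hs hl hfat hB₀ hD hne hB hnP hz hl0 hw₀ hx hN ?_
    intro T hT _ h4
    by_contra hne'
    have h8 := card_sdiff_le_eight_of_dload_ne_zero_of_lines_le_three hG hd hk hs hl htri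
      (subset_G_of_mem_shadowAt (mem_tgtSets.1 hT).1) hne'
    have := card_sdiff_coloops_eq_level_add_five hG hd hk hB hnP hz hT
    omega

end PercRepro.Shadow
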